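import Summits.HodgeConjecture.HodgeConjecture.Cruxes.BlochSeedDiscOne.SigmaH
import Summits.HodgeConjecture.HodgeConjecture.Cruxes.BlochSeedDiscOne.MinMassWindowH14
import Summits.HodgeConjecture.HodgeConjecture.Cruxes.BlochSeedDiscOne.AxisPhaseTorus

/-!
line stmt-HodgeConjecture-18881 Cruxes/BlochSeedDiscOne/Lines/birth.lean 814a6a70c14e831a stub_rung_pad4_seedAt

# OffAxisTwin — OFF THE AXIS, TOO, THE DOOR IS CARRIED BY RULE D: an explicit (A1)-clean OFF-AXIS design `D°` with `Disj`, `HallUp`,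
# `HallPlusUp 8` (tight), `μ = 32 ≠ 0`, N-mass `41 ≤ 58` and the Σ-budget of record — violating ONLY `RuleD`; it has EXACTLY the class
# tensor of the axis inhabitant `D⋆(24)` (all 625 words) and exactly its ray class measure `ω₁₄`; and its DIAGONAL TWIN `D◇` (§6)
(plan-lens-HodgeAV-strengthen g22, 2026-08-31; STRENGTHEN-MEMO-32 §4; S⁺-ledger v1.45 row #238; companion of `RayClassMeasure.lean`.)

HONESTY LABEL.  Letter-model statements about `DepthBoundA4.Design` only (Chern-character words on a letter model ≠ sheaves ≠ monads ≠ a SEED).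
NOTHING here is proved toward HC ∕ HC_CM ∕ HC_AV ∕ №4 ∕ 26512 ∕ 18881 ∕ H2; no rung, no shell of `SPlus 14 sigmaH 0` is closed.
CENSUS-NEUTRAL: `D°` FAILS the door of record (`RuleD`, certified below), so it inhabits nothing of record and refutes nothing of record.
It is kernel EVIDENCE for the off-axis programme (director-hodge R19.793 (2a)): the open sentence «every OFF-AXIS door design has N-mass ≥ 59»
(`AxisSPlus.sPlus_iff_offAxis`) genuinely needs `RuleD` — with `RuleD` deleted, every other binder of `RuleDPlate.SPlus 14 sigmaH 0` is jointly
satisfiable OFF the axis at N-mass `41`, rank `24`, `58` copies (the axis twin `D⋆(24)` of `AxisRoomInhabitant24` does the same ON the axis at 40).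

THE CONSTRUCTION — NULL SUBSTITUTION (memo-32 §4).  The class tensor `T(D)(w) = Σ ±m ∏_f coef(w_f)(c_f)` is multilinear in the per-slot
letter vectors `v(ℓ) = (1, a, β, β̄, a² − |β|²)`, and `v` is AFFINE along every axis-parallel null line; on the null line `x = 1` the three
letters `u = (13;1,0)`, `d = (12;1,1)`, `m = (11;1,2)` satisfy `v(u) − 2v(d) + v(m) = 0`.  Hence replacing the charged N-cell
`y₀ = (u,u,v,v̄)` of `D⋆(24)` (`v = (13;0,1)`) by `2·(d,u,v,v̄)` on the N-side and `(m,u,v,v̄)` on the P-side changes NO word of the class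
tensor: `D°` is (A1)-clean with `μ = 32`, e-free rows `24·14^deg`, and carries the off-axis letters `d`, `m`.  `Disj` is plain; `HallPlusUp 8`
holds because the hub entry `24·(14;0,0)⁴` is weakly above every P-entry and the new N-entry `2·(d,u,v,v̄)` is weakly above the new P-entry
(`16 + 8 ≤ 24`, `17 + 8 ≤ 26`), and it is TIGHT (`¬ HallPlusUp 9`); the Σ-H digits vanish (`sigmaH = 28·58 = 1624`, budget `2184 ≤ 3136`);
`RuleD` fails at the charged cell `(u,v,v̄,u)` (no P-cell supplies its block `(0,1)`).  Its ray class measure (`RayClassMeasure.omegaRay`) equals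
`ω₁₄` (the ray components of `2d − m` on ray `0` are those of `u`, and cancel on ray `1`) — so `D°` has `E = 0`, 14 positive and 16 negative
ray classes, as the ray dichotomy demands (checked in `eng/offaxis_twin.py`; not re-proved here).

§6 adds the DIAGONAL TWIN `D◇` (phases of `ω₁₄` on the diagonal letters `(12;±1,±1)`: (A1), `μ = −128`, N-mass 40, every charged cell
fully off-axis, again violating only `RuleD`).
KERNEL CERTIFICATE (§3–§4, §6): one 625-row `decide +kernel` table per design, `μ`, masses, the alphabet ∕ Disj ∕ weak-arrow ∕ supplier ∕ Σ-H-digit tables by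
`decide +kernel`; the Hall argument (§1 `two_le_sum`, §4 `hallPlusUp8_T`) is structural.  §5 transports `D°` to every height `h ≥ 3`.
PROVENANCE (irrelevant to validity): `eng/offaxis_twin.py` (stdlib Python, exact integers; also brute-forces Hall over all 2¹⁷ column sets).
`decide +kernel` ∕ `decide` only: no `native_decide`, no `sorry`, no `axiom`, no `instance`, no notation, no Literature fact, no
`allowUnsafeReducibility`.
-/

set_option linter.dupNamespace false
set_option autoImplicit false
set_option maxRecDepth 16384
set_option maxHeartbeats 8000000

namespace Summit.HodgeConjecture.HodgeConjecture.Cruxes.BlochSeedDiscOne.OffAxisTwin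

open Summit.HodgeConjecture.HodgeConjecture.Cruxes.BlochSeedDiscOne.DepthBoundA4
open Summit.HodgeConjecture.HodgeConjecture.Cruxes.BlochSeedDiscOne.HeightTower
open Summit.HodgeConjecture.HodgeConjecture.Cruxes.BlochSeedDiscOne.LeggedFloor (NullStep Supplies Detects RuleDP RuleD Disj)
open Summit.HodgeConjecture.HodgeConjecture.Cruxes.BlochSeedDiscOne.HallB136 (HallUp notDeadB weakLiveB weakLiveB_of)
open Summit.HodgeConjecture.HodgeConjecture.Cruxes.BlochSeedDiscOne.RuleDPlate
  (HallPlusUp hallUp_of_hallPlusUp hallUp_shiftD hallPlusUp_shiftD disj_shiftD ruleD_shiftD BudgetClause budgetClause_shiftD SPlusB SPlus)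
open Summit.HodgeConjecture.HodgeConjecture.Cruxes.BlochSeedDiscOne.SigmaH (sigmaH extPN extNP extNN extPP sigmaH_shiftD)
open Summit.HodgeConjecture.HodgeConjecture.Cruxes.BlochSeedDiscOne.MinMassWindowH14
  (toG rawT T_raw allB allB_iff anyB anyB_iff cellOf allWords mem_allWords efreeB efree_of_efreeB efreeB_of_efree blochB
   bloch_of_blochB degB deg_eq_degB onAlphaB onAlphabet_of_B mem_suppN_of mem_suppP_of exists_of_mem_suppN exists_of_mem_suppP
   cellEqB cellEqB_self suppliesB suppliesB_of)
open Summit.HodgeConjecture.HodgeConjecture.Cruxes.BlochSeedDiscOne.AxisPhaseTorus (AxisCell AxisRoom)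

/-! ## §1 Generic lemmas -/

theorem notDead_of_notDeadB {ℓ ℓ' : Letter} (h : notDeadB ℓ ℓ' = true) : NotDead ℓ ℓ' := by
  simp only [notDeadB, Bool.or_eq_true, Bool.and_eq_true, decide_eq_true_eq] at h
  rcases h with ⟨⟨ha, hx⟩, hy⟩ | ⟨ha, hb⟩
  · left
    obtain ⟨a, x, y⟩ := ℓ
    obtain ⟨a', x', y'⟩ := ℓ'
    simp only at ha hx hy
    subst ha; subst hx; subst hy
    rfl
  · right
    exact ⟨ha, by simpa only [pow_two] using hb⟩

theorem weakLive_of_weakLiveB {x y : Cell} (h : weakLiveB x y = true) : WeakLive x y := by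
  simp only [weakLiveB, Bool.and_eq_true] at h
  obtain ⟨⟨⟨h0, h1⟩, h2⟩, h3⟩ := h
  intro f
  fin_cases f
  · exact notDead_of_notDeadB h0
  · exact notDead_of_notDeadB h1
  · exact notDead_of_notDeadB h2
  · exact notDead_of_notDeadB h3

/-- two distinct entries of a list bound its mass from below by the sum of their multiplicities. -/
theorem two_le_sum {T : List (Cell × ℕ)} {a b : Cell × ℕ} (ha : a ∈ T) (hb : b ∈ T) (hab : a ≠ b) :
    a.2 + b.2 ≤ (T.map Prod.snd).sum := by
  induction T with
  | nil => simp at ha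
  | cons c T ih =>
    rw [List.map_cons, List.sum_cons]
    rcases List.mem_cons.1 ha with rfl | ha'
    · have hb' : b ∈ T := by
        rcases List.mem_cons.1 hb with h | h
        · exact absurd h.symm hab
        · exact h
      have := List.single_le_sum (fun x _ => Nat.zero_le x) b.2 (List.mem_map.2 ⟨b, hb', rfl⟩)
      omega
    · rcases List.mem_cons.1 hb with rfl | hb'
      · have := List.single_le_sum (fun x _ => Nat.zero_le x) a.2 (List.mem_map.2 ⟨a, ha', rfl⟩)
        omega
      · have := ih ha' hb'
        omega

/-- a sublist of `a :: l` avoiding `a` is a sublist of `l`. -/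
theorem sublist_tail_of_not_mem {S l : List (Cell × ℕ)} {a : Cell × ℕ} (hS : S.Sublist (a :: l)) (ha : a ∉ S) : S.Sublist l := by
  rcases List.sublist_cons_iff.1 hS with h | ⟨r, rfl, _⟩
  · exact h
  · exact absurd List.mem_cons_self ha

/-- axis cells are shift-invariant (the shift moves `a` only). -/
theorem axisCell_shiftCell (t : ℤ) (c : Cell) : AxisCell (shiftCell t c) ↔ AxisCell c := by
  simp only [AxisCell, shiftCell, Letter.isAxis, shiftL_x, shiftL_y]

theorem axisRoom_shiftD_iff (t : ℤ) (E : Design) : AxisRoom (shiftD t E) ↔ AxisRoom E := by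
  constructor
  · intro hR c hc
    have hc' : shiftCell t c ∈ (shiftD t E).suppN ++ (shiftD t E).suppP := by
      rw [suppN_shift, suppP_shift, ← List.map_append]
      exact List.mem_map.mpr ⟨c, hc, rfl⟩
    exact (axisCell_shiftCell t c).mp (hR _ hc')
  · intro hR c hc
    rw [suppN_shift, suppP_shift, ← List.map_append] at hc
    obtain ⟨c₀, hc₀, rfl⟩ := List.mem_map.mp hc
    exact (axisCell_shiftCell t c₀).mpr (hR c₀ hc₀)

/-! ## §2 The design `D°` at height 14 (32 entries; N-mass 41, P-mass 17) -/

/-- N-entries of `D°`: `24·hub⁴`, the substituted entry `2·(d,u,v,v̄)`, then the remaining 13 positive phases of `ω₁₄` as in `D⋆(24)`. -/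
def TN : List (Cell × ℕ) := [
  (cellOf ⟨14, 0, 0⟩ ⟨14, 0, 0⟩ ⟨14, 0, 0⟩ ⟨14, 0, 0⟩, 24),
  (cellOf ⟨12, 1, 1⟩ ⟨13, 1, 0⟩ ⟨13, 0, 1⟩ ⟨13, 0, -1⟩, 2),
  (cellOf ⟨13, 1, 0⟩ ⟨13, 0, 1⟩ ⟨13, 0, -1⟩ ⟨13, 1, 0⟩, 1),
  (cellOf ⟨13, 1, 0⟩ ⟨13, 0, -1⟩ ⟨13, 1, 0⟩ ⟨13, 0, 1⟩, 2),
  (cellOf ⟨13, 0, 1⟩ ⟨13, 1, 0⟩ ⟨13, 0, 1⟩ ⟨13, -1, 0⟩, 1),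
  (cellOf ⟨13, 0, 1⟩ ⟨13, 0, 1⟩ ⟨13, 1, 0⟩ ⟨13, -1, 0⟩, 1),
  (cellOf ⟨13, 0, 1⟩ ⟨13, -1, 0⟩ ⟨13, 0, 1⟩ ⟨13, 1, 0⟩, 1),
  (cellOf ⟨13, 0, 1⟩ ⟨13, 0, -1⟩ ⟨13, -1, 0⟩ ⟨13, -1, 0⟩, 1),
  (cellOf ⟨13, -1, 0⟩ ⟨13, 1, 0⟩ ⟨13, 0, 1⟩ ⟨13, 0, 1⟩, 1),
  (cellOf ⟨13, -1, 0⟩ ⟨13, 0, 1⟩ ⟨13, -1, 0⟩ ⟨13, 0, -1⟩, 2),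
  (cellOf ⟨13, -1, 0⟩ ⟨13, 0, -1⟩ ⟨13, 0, -1⟩ ⟨13, 1, 0⟩, 1),
  (cellOf ⟨13, 0, -1⟩ ⟨13, 1, 0⟩ ⟨13, 0, -1⟩ ⟨13, -1, 0⟩, 1),
  (cellOf ⟨13, 0, -1⟩ ⟨13, -1, 0⟩ ⟨13, 1, 0⟩ ⟨13, 0, -1⟩, 1),
  (cellOf ⟨13, 0, -1⟩ ⟨13, -1, 0⟩ ⟨13, -1, 0⟩ ⟨13, 0, 1⟩, 1),
  (cellOf ⟨13, 0, -1⟩ ⟨13, -1, 0⟩ ⟨13, 0, -1⟩ ⟨13, 1, 0⟩, 1)]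

/-- P-entries of `D°`: the substituted entry `(m,u,v,v̄)`, then the 16 negative phases of `ω₁₄` as in `D⋆(24)`. -/
def TP : List (Cell × ℕ) := [
  (cellOf ⟨11, 1, 2⟩ ⟨13, 1, 0⟩ ⟨13, 0, 1⟩ ⟨13, 0, -1⟩, 1),
  (cellOf ⟨13, 1, 0⟩ ⟨13, 1, 0⟩ ⟨13, 1, 0⟩ ⟨13, -1, 0⟩, 1),
  (cellOf ⟨13, 1, 0⟩ ⟨13, -1, 0⟩ ⟨13, 1, 0⟩ ⟨13, 1, 0⟩, 1),
  (cellOf ⟨13, 1, 0⟩ ⟨13, -1, 0⟩ ⟨13, 0, -1⟩ ⟨13, 0, 1⟩, 1),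
  (cellOf ⟨13, 1, 0⟩ ⟨13, 0, -1⟩ ⟨13, 0, 1⟩ ⟨13, -1, 0⟩, 1),
  (cellOf ⟨13, 0, 1⟩ ⟨13, 1, 0⟩ ⟨13, 1, 0⟩ ⟨13, 0, 1⟩, 1),
  (cellOf ⟨13, 0, 1⟩ ⟨13, 1, 0⟩ ⟨13, -1, 0⟩ ⟨13, 0, -1⟩, 1),
  (cellOf ⟨13, 0, 1⟩ ⟨13, 0, 1⟩ ⟨13, 0, 1⟩ ⟨13, 0, -1⟩, 1),
  (cellOf ⟨13, 0, 1⟩ ⟨13, 0, -1⟩ ⟨13, 0, 1⟩ ⟨13, 0, 1⟩, 1),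
  (cellOf ⟨13, -1, 0⟩ ⟨13, 1, 0⟩ ⟨13, -1, 0⟩ ⟨13, -1, 0⟩, 1),
  (cellOf ⟨13, -1, 0⟩ ⟨13, 0, 1⟩ ⟨13, 0, 1⟩ ⟨13, -1, 0⟩, 1),
  (cellOf ⟨13, -1, 0⟩ ⟨13, -1, 0⟩ ⟨13, -1, 0⟩ ⟨13, 1, 0⟩, 1),
  (cellOf ⟨13, -1, 0⟩ ⟨13, -1, 0⟩ ⟨13, 0, -1⟩ ⟨13, 0, -1⟩, 1),
  (cellOf ⟨13, 0, -1⟩ ⟨13, 0, 1⟩ ⟨13, -1, 0⟩ ⟨13, 1, 0⟩, 1),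
  (cellOf ⟨13, 0, -1⟩ ⟨13, 0, 1⟩ ⟨13, 0, -1⟩ ⟨13, 0, -1⟩, 1),
  (cellOf ⟨13, 0, -1⟩ ⟨13, 0, -1⟩ ⟨13, 1, 0⟩ ⟨13, 1, 0⟩, 1),
  (cellOf ⟨13, 0, -1⟩ ⟨13, 0, -1⟩ ⟨13, 0, -1⟩ ⟨13, 0, 1⟩, 1)]

/-- `D°`, the off-axis twin of `D⋆(24)`, at height 14. -/
def Dring : Design := ⟨TN, TP⟩

/-- the hub cell `(14;0,0)⁴`. -/
def hub4 : Cell := cellOf ⟨14, 0, 0⟩ ⟨14, 0, 0⟩ ⟨14, 0, 0⟩ ⟨14, 0, 0⟩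

/-- the substituted N-cell `(d,u,v,v̄)`, `d = (12;1,1)` OFF the axis. -/
def zc : Cell := cellOf ⟨12, 1, 1⟩ ⟨13, 1, 0⟩ ⟨13, 0, 1⟩ ⟨13, 0, -1⟩

/-- the substituted P-cell `(m,u,v,v̄)`, `m = (11;1,2)` OFF the axis. -/
def xc : Cell := cellOf ⟨11, 1, 2⟩ ⟨13, 1, 0⟩ ⟨13, 0, 1⟩ ⟨13, 0, -1⟩

/-- the RULE-D witness: the charged N-cell `(u,v,v̄,u)` (phases `(0,1,3,0)`). -/
def y1 : Cell := cellOf ⟨13, 1, 0⟩ ⟨13, 0, 1⟩ ⟨13, 0, -1⟩ ⟨13, 1, 0⟩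

theorem hubE_mem : (hub4, 24) ∈ Dring.N := List.mem_cons_self

theorem zE_mem : (zc, 2) ∈ Dring.N := List.mem_cons_of_mem _ List.mem_cons_self

theorem xE_mem : (xc, 1) ∈ Dring.P := List.mem_cons_self

theorem y1_mem : (y1, 1) ∈ Dring.N := List.mem_cons_of_mem _ (List.mem_cons_of_mem _ List.mem_cons_self)

theorem TP_eq : Dring.P = (xc, 1) :: TP.tail := rfl

/-! ## §3 Kernel computations for `D°` -/

/-- one row of the class table: e-free words evaluate to `24·14^deg`, every other word except the two Bloch words vanishes —
EXACTLY the table of `D⋆(24)` (`AxisRoomInhabitant24.rowD`). -/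
def rowT (w : Word) : Bool :=
  bif efreeB w then decide (rawT TN TP w = (24 * 14 ^ degB w, 0)) else (blochB w || decide (rawT TN TP w = (0, 0)))

theorem tableT : allB allWords rowT = true := by decide +kernel

theorem mu_rawT : rawT TN TP Word.eeee = (32, 0) := by decide +kernel

theorem EEEE_rawT : rawT TN TP Word.EEEE = (32, 0) := by decide +kernel

theorem copies_T : Dring.copies = 58 := by decide +kernel

theorem rank_T : Dring.rank = 24 := by decide +kernel

theorem massP_T : (Dring.P.map Prod.snd).sum = 17 := by decide +kernel

theorem massP_tail : (TP.tail.map Prod.snd).sum = 16 := by decide +kernel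

theorem massN_T : (Dring.N.map Prod.snd).sum = 41 := by decide +kernel

theorem alphaTN : allB TN (fun cm => onAlphaB 14 cm.1) = true := by decide +kernel

theorem alphaTP : allB TP (fun cm => onAlphaB 14 cm.1) = true := by decide +kernel

/-- every letter of `D°` has level `≥ 11` (co-level `≤ 3`): used to transport `D°` to every height `h ≥ 3`. -/
def levB (c : Cell) : Bool := decide (11 ≤ (c 0).a) && decide (11 ≤ (c 1).a) && decide (11 ≤ (c 2).a) && decide (11 ≤ (c 3).a)

theorem levTN : allB TN (fun cm => levB cm.1) = true := by decide +kernel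

theorem levTP : allB TP (fun cm => levB cm.1) = true := by decide +kernel

theorem disjT_table : allB TN (fun cn => allB TP (fun cm => !cellEqB cm.1 cn.1)) = true := by decide +kernel

/-- the hub entry is weakly live above every P-entry … -/
theorem hub_above_P : allB TP (fun cm => weakLiveB cm.1 hub4) = true := by decide +kernel

/-- … and the substituted N-cell is weakly live above the substituted P-cell (slot `0`: the null step `m → d`). -/
theorem x_below_z : weakLiveB xc zc = true := by decide +kernel

/-- the weakly-live N-neighbourhood of the sixteen OLD P-entries is the hub entry alone (capacity `24`; tightness of the surplus). -/
def TD : List (Cell × ℕ) := Dring.N.filter fun cn => anyB TP.tail (fun cm => weakLiveB cm.1 cn.1)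

theorem TD_capacity : (TD.map Prod.snd).sum = 24 := by decide +kernel

/-- no P-entry supplies the charged N-cell `y1` on the block `(0,1)`. -/
theorem y1_noSupplier : allB TP (fun cm => !suppliesB cm.1 y1 (0 : Fin 4) (1 : Fin 4)) = true := by decide +kernel

/-- Σ-H digits: no cross pair and no same-side pair of `D°` sits in a priced degree. -/
theorem extPN_T_one : extPN Dring 1 = 0 := by decide +kernel
theorem extNP_T_three : extNP Dring 3 = 0 := by decide +kernel
theorem extNN_T_two : extNN Dring 2 = 0 := by decide +kernel
theorem extPP_T_two : extPP Dring 2 = 0 := by decide +kernel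

/-! ## §4 The certificate for `D°` at height 14 -/

theorem onAlphabet_T : Dring.OnAlphabet 14 := by
  intro c hc f
  rcases List.mem_append.1 hc with hN | hP
  · obtain ⟨m, hm⟩ := exists_of_mem_suppN hN
    exact onAlphabet_of_B ((allB_iff _ _).1 alphaTN (c, m) hm) f
  · obtain ⟨m, hm⟩ := exists_of_mem_suppP hP
    exact onAlphabet_of_B ((allB_iff _ _).1 alphaTP (c, m) hm) f

theorem zc_suppN : zc ∈ Dring.suppN := mem_suppN_of zE_mem (by decide)

/-- **`D°` is NOT in the axis room**: its N-cell `(d,u,v,v̄)` carries the off-axis letter `d = (12;1,1)`. -/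
theorem not_axisRoom_T : ¬ AxisRoom Dring := by
  intro hR
  have h := hR zc (List.mem_append_left _ zc_suppN) 0
  unfold Letter.isAxis at h
  revert h
  decide

theorem level_of_B {c : Cell} (hc : levB c = true) : ∀ f : Fin 4, 11 ≤ (c f).a := by
  simp only [levB, Bool.and_eq_true, decide_eq_true_eq] at hc
  obtain ⟨⟨⟨h0, h1⟩, h2⟩, h3⟩ := hc
  intro f
  fin_cases f
  · exact h0
  · exact h1
  · exact h2
  · exact h3

theorem level_T : ∀ c ∈ Dring.suppN ++ Dring.suppP, ∀ f : Fin 4, 11 ≤ (c f).a := by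
  intro c hc f
  rcases List.mem_append.1 hc with hN | hP
  · obtain ⟨m, hm⟩ := exists_of_mem_suppN hN
    exact level_of_B ((allB_iff _ _).1 levTN (c, m) hm) f
  · obtain ⟨m, hm⟩ := exists_of_mem_suppP hP
    exact level_of_B ((allB_iff _ _).1 levTP (c, m) hm) f

theorem T_closedT (w : Word) : Dring.T w = toG (rawT TN TP w) := T_raw Dring w

/-- HUB ROWS: every e-free word evaluates to `24·14^{deg}` — the class of `D°` is `24·exp(14H) + μ·(Bloch words)`, word for word that of `D⋆(24)`. -/
theorem efree_rows_T (w : Word) (hw : w.efree) : Dring.T w = ⟨24 * 14 ^ w.deg, 0⟩ := by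
  have hr := (allB_iff _ _).1 tableT w (mem_allWords w)
  unfold rowT at hr
  rw [efreeB_of_efree hw] at hr
  simp only [cond_true, decide_eq_true_eq] at hr
  rw [T_closedT, hr, deg_eq_degB]
  rfl

/-- MIXED ROWS: every e-mixed word other than the two Bloch words vanishes. -/
theorem mixed_rows_T (w : Word) (hne : ¬ w.efree) (h1 : w ≠ Word.eeee) (h2 : w ≠ Word.EEEE) : Dring.T w = 0 := by
  have hr := (allB_iff _ _).1 tableT w (mem_allWords w)
  unfold rowT at hr
  cases hb : efreeB w with
  | true => exact (hne (efree_of_efreeB hb)).elim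
  | false =>
    rw [hb] at hr
    simp only [cond_false, Bool.or_eq_true, decide_eq_true_eq] at hr
    rcases hr with hbl | hz
    · rcases bloch_of_blochB hbl with h | h
      · exact (h1 h).elim
      · exact (h2 h).elim
    · rw [T_closedT, hz]; ext <;> simp [toG]

theorem a1_T : Dring.A1 :=
  ⟨fun w hne h1 h2 => mixed_rows_T w hne h1 h2, fun w w' hw hw' hd => by rw [efree_rows_T w hw, efree_rows_T w' hw', hd]⟩

theorem mu_T : Dring.mu = ⟨32, 0⟩ := by
  show Dring.T Word.eeee = _
  rw [T_closedT, mu_rawT]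
  rfl

theorem mu_ne_T : Dring.mu ≠ 0 := by
  rw [mu_T]
  decide

theorem T_EEEE_T : Dring.T Word.EEEE = ⟨32, 0⟩ := by
  rw [T_closedT, EEEE_rawT]
  rfl

theorem disj_T : Disj Dring := by
  intro c hN hP
  obtain ⟨n, hn⟩ := exists_of_mem_suppN hN
  obtain ⟨m, hm⟩ := exists_of_mem_suppP hP
  have h1 := (allB_iff _ _).1 ((allB_iff _ _).1 disjT_table (c, n) hn) (c, m) hm
  rw [cellEqB_self] at h1
  exact Bool.noConfusion h1

theorem hub_above (cm : Cell × ℕ) (hcm : cm ∈ Dring.P) : WeakLive cm.1 hub4 :=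
  weakLive_of_weakLiveB ((allB_iff _ _).1 hub_above_P cm hcm)

theorem hubE_ne_zE : ((hub4, 24) : Cell × ℕ) ≠ (zc, 2) := by decide

/-- **`D°` satisfies PortHall₈.**  Let `S` be a column set of positive mass and `T` its covering row list.  The hub entry (mass `24`) is in `T`.
If the substituted P-entry `(m,u,v,v̄)` is in `S`, the substituted N-entry `2·(d,u,v,v̄)` is in `T` as well and `mass S + 8 ≤ 17 + 8 ≤ 24 + 2`;
otherwise `S` is a column set of the sixteen old P-entries and `mass S + 8 ≤ 16 + 8 = 24`. -/
theorem hallPlusUp8_T : HallPlusUp Dring 8 := by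
  intro S hS hpos T hT hcov
  obtain ⟨cm, hcm⟩ : ∃ cm, cm ∈ S := by
    cases S with
    | nil => simp at hpos
    | cons a l => exact ⟨a, List.mem_cons_self⟩
  have hhub : (hub4, 24) ∈ T := hcov _ hubE_mem ⟨cm, hcm, hub_above cm (hS.subset hcm)⟩
  have h24 : 24 ≤ (T.map Prod.snd).sum :=
    List.single_le_sum (fun a _ => Nat.zero_le a) 24 (List.mem_map.2 ⟨(hub4, 24), hhub, rfl⟩)
  by_cases hx : (xc, 1) ∈ S
  · have hz : (zc, 2) ∈ T := hcov _ zE_mem ⟨(xc, 1), hx, weakLive_of_weakLiveB x_below_z⟩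
    have h26 := two_le_sum hhub hz hubE_ne_zE
    have hle : (S.map Prod.snd).sum ≤ (Dring.P.map Prod.snd).sum := (hS.map Prod.snd).sum_le_sum (fun a _ => Nat.zero_le a)
    rw [massP_T] at hle
    simp only at h26
    omega
  · rw [TP_eq] at hS
    have hS' := sublist_tail_of_not_mem hS hx
    have hle : (S.map Prod.snd).sum ≤ (TP.tail.map Prod.snd).sum := (hS'.map Prod.snd).sum_le_sum (fun a _ => Nat.zero_le a)
    rw [massP_tail] at hle
    omega

theorem hallUp_T : HallUp Dring := hallUp_of_hallPlusUp Dring 8 hallPlusUp8_T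

theorem tail_sublist : TP.tail.Sublist Dring.P := by
  rw [TP_eq]
  exact List.sublist_cons_self _ _

theorem TD_sublist : TD.Sublist Dring.N := List.filter_sublist

theorem TD_covers : ∀ cn ∈ Dring.N, (∃ cm ∈ TP.tail, WeakLive cm.1 cn.1) → cn ∈ TD := by
  intro cn hcn hex
  obtain ⟨cm, hcm, hw⟩ := hex
  unfold TD
  exact List.mem_filter.2 ⟨hcn, (anyB_iff _ _).2 ⟨cm, hcm, weakLiveB_of hw⟩⟩

/-- **and the surplus is TIGHT**: `¬ HallPlusUp D° 9` (the sixteen old P-entries see only the hub entry: `16 + 9 > 24`). -/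
theorem not_hallPlusUp9_T : ¬ HallPlusUp Dring 9 := by
  intro h
  have h1 := h TP.tail tail_sublist (by rw [massP_tail]; decide) TD TD_sublist TD_covers
  rw [massP_tail, TD_capacity] at h1
  omega

theorem sigmaH_T : sigmaH Dring = 1624 := by
  unfold sigmaH
  rw [copies_T, extPN_T_one, extNP_T_three, extNN_T_two, extPP_T_two]
  norm_num

/-- the Σ-budget of record holds with `952` to spare: `1624 + 28·(24 − 4) + 0 = 2184 ≤ 3136`. -/
theorem budget_T : BudgetClause sigmaH 0 Dring := by
  unfold BudgetClause
  rw [sigmaH_T, rank_T]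
  norm_num

theorem y1_suppN : y1 ∈ Dring.suppN := mem_suppN_of y1_mem (by decide)

theorem y1_detects : Detects y1 (0 : Fin 4) (1 : Fin 4) := by
  unfold Detects y1
  decide

/-- **`D°` violates RULE D** (N-side clause) at the charged cell `y1`, block `(0,1)`. -/
theorem not_ruleD_T : ¬ RuleD Dring := by
  intro h
  obtain ⟨x, hx, hs⟩ := h.1 y1 y1_suppN (0 : Fin 4) (1 : Fin 4) (by decide) y1_detects
  obtain ⟨m, hm⟩ := exists_of_mem_suppP hx
  have hb := (allB_iff _ _).1 y1_noSupplier (x, m) hm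
  rw [suppliesB_of hs] at hb
  exact Bool.noConfusion hb

/-- N-mass `41 ≤ 58`: `D°` sits far inside the N-mass cap that the Σ-budget imposes (`AxisSPlus.nmass_le_58_of_budget`). -/
theorem nmass_T : (Dring.N.map Prod.snd).sum = 41 ∧ (Dring.N.map Prod.snd).sum ≤ 58 := by
  rw [massN_T]
  exact ⟨rfl, by norm_num⟩

/-- THE CERTIFICATE (height 14): every binder of `RuleDPlate.SPlus 14 sigmaH 0` except `RuleD`, OFF the axis room, at rank 24, N-mass 41. -/
theorem cert_T : Dring.OnAlphabet 14 ∧ ¬ AxisRoom Dring ∧ Disj Dring ∧ Dring.A1 ∧ HallUp Dring ∧ HallPlusUp Dring 8 ∧ Dring.mu = ⟨32, 0⟩ ∧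
    Dring.rank = 24 ∧ Dring.copies = 58 ∧ (Dring.N.map Prod.snd).sum = 41 ∧ sigmaH Dring = 1624 ∧ BudgetClause sigmaH 0 Dring ∧
    (∀ w : Word, w.efree → Dring.T w = ⟨24 * 14 ^ w.deg, 0⟩) ∧ ¬ HallPlusUp Dring 9 ∧ ¬ RuleD Dring :=
  ⟨onAlphabet_T, not_axisRoom_T, disj_T, a1_T, hallUp_T, hallPlusUp8_T, mu_T, rank_T, copies_T, massN_T, sigmaH_T, budget_T, efree_rows_T,
    not_hallPlusUp9_T, not_ruleD_T⟩

/-- **OFF THE AXIS, TOO, RULE D IS LOAD-BEARING**: the `SPlus 14 sigmaH 0` sentence restricted to off-axis designs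
(`AxisSPlus.sPlus_iff_offAxis`) with `RuleD` deleted is FALSE — witnessed by `D°` at N-mass `41 ≤ 58`. -/
theorem not_ruleDfree_door_offAxis :
    ¬ (∀ D : Design, D.OnAlphabet 14 → ¬ AxisRoom D → Disj D → D.A1 → HallUp D → HallPlusUp D 8 → D.mu ≠ 0 →
        BudgetClause sigmaH 0 D → False) :=
  fun H => H Dring onAlphabet_T not_axisRoom_T disj_T a1_T hallUp_T hallPlusUp8_T mu_ne_T budget_T

/-- hence any N-MASS LAW «off-axis door designs have N-mass ≥ 59» must USE `RuleD`: without it N-mass `41` occurs. -/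
theorem not_nmassLaw_ruleDfree_offAxis :
    ¬ (∀ D : Design, D.OnAlphabet 14 → ¬ AxisRoom D → Disj D → D.A1 → HallUp D → HallPlusUp D 8 → D.mu ≠ 0 →
        59 ≤ (D.N.map Prod.snd).sum) := by
  intro H
  have h := H Dring onAlphabet_T not_axisRoom_T disj_T a1_T hallUp_T hallPlusUp8_T mu_ne_T
  rw [massN_T] at h
  omega

/-! ## §5 Every height `h ≥ 3` (transport by `HeightTower.shiftD (h − 14)`) -/

/-- `D°` transported to height `h`. -/
def DringAt (h : ℤ) : Design := shiftD (h - 14) Dring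

theorem onAlphabet_DringAt {h : ℤ} (hh : 3 ≤ h) : (DringAt h).OnAlphabet h := by
  have e : h = 14 + (h - 14) := by ring
  rw [DringAt, e, add_sub_cancel_left]
  exact onAlphabet_shift Dring 14 (h - 14) onAlphabet_T (fun c hc f => by have := level_T c hc f; omega)

/-- **THE OFF-AXIS TWIN AT EVERY HEIGHT `h ≥ 3`**: all binders of the door of record except `RuleD`, off the axis room, rank 24, 58 copies, `μ = 32`. -/
theorem cert_DringAt {h : ℤ} (hh : 3 ≤ h) :
    (DringAt h).OnAlphabet h ∧ ¬ AxisRoom (DringAt h) ∧ Disj (DringAt h) ∧ (DringAt h).A1 ∧ HallUp (DringAt h) ∧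
    HallPlusUp (DringAt h) 8 ∧ (DringAt h).mu = ⟨32, 0⟩ ∧ (DringAt h).rank = 24 ∧ (DringAt h).copies = 58 ∧
    BudgetClause sigmaH 0 (DringAt h) ∧ ¬ RuleD (DringAt h) := by
  refine ⟨onAlphabet_DringAt hh, fun hR => not_axisRoom_T ((axisRoom_shiftD_iff _ _).mp hR), (disj_shiftD _ _).mpr disj_T,
    a1_shiftD _ _ a1_T, (hallUp_shiftD _ _).mpr hallUp_T, (hallPlusUp_shiftD _ _ 8).mpr hallPlusUp8_T, ?_, ?_, ?_, ?_, ?_⟩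
  · rw [DringAt, mu_shiftD, mu_T]
  · rw [DringAt, rank_shift, rank_T]
  · rw [DringAt, copies_shift, copies_T]
  · exact (budgetClause_shiftD sigmaH 0 sigmaH_shiftD _ _).mpr budget_T
  · exact fun hr => not_ruleD_T ((ruleD_shiftD _ _).mp hr)

/-- **RULE D IS LOAD-BEARING OFF THE AXIS AT EVERY HEIGHT `h ≥ 3`.** -/
theorem not_ruleDfree_door_offAxis_at {h : ℤ} (hh : 3 ≤ h) :
    ¬ (∀ D : Design, D.OnAlphabet h → ¬ AxisRoom D → Disj D → D.A1 → HallUp D → HallPlusUp D 8 → D.mu ≠ 0 →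
        BudgetClause sigmaH 0 D → False) := by
  intro H
  obtain ⟨hA, hR, hd, h1, hu, hp, hμ, _, _, hb, _⟩ := cert_DringAt hh
  exact H (DringAt h) hA hR hd h1 hu hp (by rw [hμ]; decide) hb

/-! ## §6 The DIAGONAL TWIN `D◇`: the phases of `ω₁₄` placed on the four DIAGONAL letters `(12;±1,±1)` — every charged cell fully off-axis

The map `u_p = (13; i^p) ↦ d_p = (12; (1+i)·i^p)` keeps the per-slot structure the phase-torus realisation uses (`a`, `a² − |β|²` constant on the
four letters, `β(d_p) = (1+i)·i^p`), so `D◇ := 24·hub⁴ + Σ_{pt14} ±(d_{p₀},…,d_{p₃})` is again (A1)-clean, with `μ = (1−i)⁴·32 = −128`, the same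
masses as `D⋆(24)` (N-mass 40, P-mass 16, rank 24, 56 copies), the same Σ-H value `1568`, Hall surplus exactly 8, and it violates ONLY `RuleD`
(a block of two diagonal letters can only be supplied through a level-11 letter; there is none).  Every one of its 30 charged cells has FOUR
off-axis letters, i.e. touches 16 ray classes (`RayClassMeasure.touch_card_le` is attained): class counting alone prices such designs at
nothing beyond the ray dichotomy — again only `RuleD` can carry an off-axis N-mass law. -/

/-- N-entries of `D◇`: `24·hub⁴` and the 14 positive phases of `ω₁₄` on diagonal letters. -/
def GN : List (Cell × ℕ) := [
  (cellOf ⟨14, 0, 0⟩ ⟨14, 0, 0⟩ ⟨14, 0, 0⟩ ⟨14, 0, 0⟩, 24),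
  (cellOf ⟨12, 1, 1⟩ ⟨12, 1, 1⟩ ⟨12, -1, 1⟩ ⟨12, 1, -1⟩, 1),
  (cellOf ⟨12, 1, 1⟩ ⟨12, -1, 1⟩ ⟨12, 1, -1⟩ ⟨12, 1, 1⟩, 1),
  (cellOf ⟨12, 1, 1⟩ ⟨12, 1, -1⟩ ⟨12, 1, 1⟩ ⟨12, -1, 1⟩, 2),
  (cellOf ⟨12, -1, 1⟩ ⟨12, 1, 1⟩ ⟨12, -1, 1⟩ ⟨12, -1, -1⟩, 1),
  (cellOf ⟨12, -1, 1⟩ ⟨12, -1, 1⟩ ⟨12, 1, 1⟩ ⟨12, -1, -1⟩, 1),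
  (cellOf ⟨12, -1, 1⟩ ⟨12, -1, -1⟩ ⟨12, -1, 1⟩ ⟨12, 1, 1⟩, 1),
  (cellOf ⟨12, -1, 1⟩ ⟨12, 1, -1⟩ ⟨12, -1, -1⟩ ⟨12, -1, -1⟩, 1),
  (cellOf ⟨12, -1, -1⟩ ⟨12, 1, 1⟩ ⟨12, -1, 1⟩ ⟨12, -1, 1⟩, 1),
  (cellOf ⟨12, -1, -1⟩ ⟨12, -1, 1⟩ ⟨12, -1, -1⟩ ⟨12, 1, -1⟩, 2),
  (cellOf ⟨12, -1, -1⟩ ⟨12, 1, -1⟩ ⟨12, 1, -1⟩ ⟨12, 1, 1⟩, 1),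
  (cellOf ⟨12, 1, -1⟩ ⟨12, 1, 1⟩ ⟨12, 1, -1⟩ ⟨12, -1, -1⟩, 1),
  (cellOf ⟨12, 1, -1⟩ ⟨12, -1, -1⟩ ⟨12, 1, 1⟩ ⟨12, 1, -1⟩, 1),
  (cellOf ⟨12, 1, -1⟩ ⟨12, -1, -1⟩ ⟨12, -1, -1⟩ ⟨12, -1, 1⟩, 1),
  (cellOf ⟨12, 1, -1⟩ ⟨12, -1, -1⟩ ⟨12, 1, -1⟩ ⟨12, 1, 1⟩, 1)
]

/-- P-entries of `D◇`: the 16 negative phases of `ω₁₄` on diagonal letters. -/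
def GP : List (Cell × ℕ) := [
  (cellOf ⟨12, 1, 1⟩ ⟨12, 1, 1⟩ ⟨12, 1, 1⟩ ⟨12, -1, -1⟩, 1),
  (cellOf ⟨12, 1, 1⟩ ⟨12, -1, -1⟩ ⟨12, 1, 1⟩ ⟨12, 1, 1⟩, 1),
  (cellOf ⟨12, 1, 1⟩ ⟨12, -1, -1⟩ ⟨12, 1, -1⟩ ⟨12, -1, 1⟩, 1),
  (cellOf ⟨12, 1, 1⟩ ⟨12, 1, -1⟩ ⟨12, -1, 1⟩ ⟨12, -1, -1⟩, 1),
  (cellOf ⟨12, -1, 1⟩ ⟨12, 1, 1⟩ ⟨12, 1, 1⟩ ⟨12, -1, 1⟩, 1),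
  (cellOf ⟨12, -1, 1⟩ ⟨12, 1, 1⟩ ⟨12, -1, -1⟩ ⟨12, 1, -1⟩, 1),
  (cellOf ⟨12, -1, 1⟩ ⟨12, -1, 1⟩ ⟨12, -1, 1⟩ ⟨12, 1, -1⟩, 1),
  (cellOf ⟨12, -1, 1⟩ ⟨12, 1, -1⟩ ⟨12, -1, 1⟩ ⟨12, -1, 1⟩, 1),
  (cellOf ⟨12, -1, -1⟩ ⟨12, 1, 1⟩ ⟨12, -1, -1⟩ ⟨12, -1, -1⟩, 1),
  (cellOf ⟨12, -1, -1⟩ ⟨12, -1, 1⟩ ⟨12, -1, 1⟩ ⟨12, -1, -1⟩, 1),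
  (cellOf ⟨12, -1, -1⟩ ⟨12, -1, -1⟩ ⟨12, -1, -1⟩ ⟨12, 1, 1⟩, 1),
  (cellOf ⟨12, -1, -1⟩ ⟨12, -1, -1⟩ ⟨12, 1, -1⟩ ⟨12, 1, -1⟩, 1),
  (cellOf ⟨12, 1, -1⟩ ⟨12, -1, 1⟩ ⟨12, -1, -1⟩ ⟨12, 1, 1⟩, 1),
  (cellOf ⟨12, 1, -1⟩ ⟨12, -1, 1⟩ ⟨12, 1, -1⟩ ⟨12, 1, -1⟩, 1),
  (cellOf ⟨12, 1, -1⟩ ⟨12, 1, -1⟩ ⟨12, 1, 1⟩ ⟨12, 1, 1⟩, 1),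
  (cellOf ⟨12, 1, -1⟩ ⟨12, 1, -1⟩ ⟨12, 1, -1⟩ ⟨12, -1, 1⟩, 1)
]

/-- `D◇`, the diagonal twin of `D⋆(24)`, at height 14. -/
def Ddiag : Design := ⟨GN, GP⟩

/-- the RULE-D witness for `D◇`: the charged N-cell `(d₀,d₀,d₁,d₃)`. -/
def yd : Cell := cellOf ⟨12, 1, 1⟩ ⟨12, 1, 1⟩ ⟨12, -1, 1⟩ ⟨12, 1, -1⟩

theorem hubE_mem_G : (hub4, 24) ∈ Ddiag.N := List.mem_cons_self

theorem yd_mem : (yd, 1) ∈ Ddiag.N := List.mem_cons_of_mem _ List.mem_cons_self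

def rowG (w : Word) : Bool :=
  bif efreeB w then decide (rawT GN GP w = (24 * 14 ^ degB w, 0)) else (blochB w || decide (rawT GN GP w = (0, 0)))

theorem tableG : allB allWords rowG = true := by decide +kernel

theorem mu_rawG : rawT GN GP Word.eeee = (-128, 0) := by decide +kernel

theorem copies_G : Ddiag.copies = 56 := by decide +kernel

theorem rank_G : Ddiag.rank = 24 := by decide +kernel

theorem massP_G : (Ddiag.P.map Prod.snd).sum = 16 := by decide +kernel

theorem massN_G : (Ddiag.N.map Prod.snd).sum = 40 := by decide +kernel

theorem alphaGN : allB GN (fun cm => onAlphaB 14 cm.1) = true := by decide +kernel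

theorem alphaGP : allB GP (fun cm => onAlphaB 14 cm.1) = true := by decide +kernel

theorem disjG_table : allB GN (fun cn => allB GP (fun cm => !cellEqB cm.1 cn.1)) = true := by decide +kernel

theorem hub_above_GP : allB GP (fun cm => weakLiveB cm.1 hub4) = true := by decide +kernel

/-- the weakly-live N-neighbourhood of ALL P-entries of `D◇` is the hub entry alone (tightness of the surplus). -/
def TG : List (Cell × ℕ) := Ddiag.N.filter fun cn => anyB GP (fun cm => weakLiveB cm.1 cn.1)

theorem TG_capacity : (TG.map Prod.snd).sum = 24 := by decide +kernel

theorem yd_noSupplier : allB GP (fun cm => !suppliesB cm.1 yd (0 : Fin 4) (1 : Fin 4)) = true := by decide +kernel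

theorem extPN_G_one : extPN Ddiag 1 = 0 := by decide +kernel
theorem extNP_G_three : extNP Ddiag 3 = 0 := by decide +kernel
theorem extNN_G_two : extNN Ddiag 2 = 0 := by decide +kernel
theorem extPP_G_two : extPP Ddiag 2 = 0 := by decide +kernel

theorem onAlphabet_G : Ddiag.OnAlphabet 14 := by
  intro c hc f
  rcases List.mem_append.1 hc with hN | hP
  · obtain ⟨m, hm⟩ := exists_of_mem_suppN hN
    exact onAlphabet_of_B ((allB_iff _ _).1 alphaGN (c, m) hm) f
  · obtain ⟨m, hm⟩ := exists_of_mem_suppP hP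
    exact onAlphabet_of_B ((allB_iff _ _).1 alphaGP (c, m) hm) f

theorem yd_suppN : yd ∈ Ddiag.suppN := mem_suppN_of yd_mem (by decide)

/-- `D◇` is not in the axis room (no charged letter of it is axis). -/
theorem not_axisRoom_G : ¬ AxisRoom Ddiag := by
  intro hR
  have h := hR yd (List.mem_append_left _ yd_suppN) 0
  unfold Letter.isAxis at h
  revert h
  decide

theorem T_closedG (w : Word) : Ddiag.T w = toG (rawT GN GP w) := T_raw Ddiag w

theorem efree_rows_G (w : Word) (hw : w.efree) : Ddiag.T w = ⟨24 * 14 ^ w.deg, 0⟩ := by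
  have hr := (allB_iff _ _).1 tableG w (mem_allWords w)
  unfold rowG at hr
  rw [efreeB_of_efree hw] at hr
  simp only [cond_true, decide_eq_true_eq] at hr
  rw [T_closedG, hr, deg_eq_degB]
  rfl

theorem mixed_rows_G (w : Word) (hne : ¬ w.efree) (h1 : w ≠ Word.eeee) (h2 : w ≠ Word.EEEE) : Ddiag.T w = 0 := by
  have hr := (allB_iff _ _).1 tableG w (mem_allWords w)
  unfold rowG at hr
  cases hb : efreeB w with
  | true => exact (hne (efree_of_efreeB hb)).elim
  | false =>
    rw [hb] at hr
    simp only [cond_false, Bool.or_eq_true, decide_eq_true_eq] at hr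
    rcases hr with hbl | hz
    · rcases bloch_of_blochB hbl with h | h
      · exact (h1 h).elim
      · exact (h2 h).elim
    · rw [T_closedG, hz]; ext <;> simp [toG]

theorem a1_G : Ddiag.A1 :=
  ⟨fun w hne h1 h2 => mixed_rows_G w hne h1 h2, fun w w' hw hw' hd => by rw [efree_rows_G w hw, efree_rows_G w' hw', hd]⟩

theorem mu_G : Ddiag.mu = ⟨-128, 0⟩ := by
  show Ddiag.T Word.eeee = _
  rw [T_closedG, mu_rawG]
  rfl

theorem mu_ne_G : Ddiag.mu ≠ 0 := by
  rw [mu_G]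
  decide

theorem disj_G : Disj Ddiag := by
  intro c hN hP
  obtain ⟨n, hn⟩ := exists_of_mem_suppN hN
  obtain ⟨m, hm⟩ := exists_of_mem_suppP hP
  have h1 := (allB_iff _ _).1 ((allB_iff _ _).1 disjG_table (c, n) hn) (c, m) hm
  rw [cellEqB_self] at h1
  exact Bool.noConfusion h1

/-- **`D◇` satisfies PortHall₈** by the heavy hub alone: every P-entry lies weakly below `hub⁴` (mass 24 = 16 + 8). -/
theorem hallPlusUp8_G : HallPlusUp Ddiag 8 := by
  intro S hS hpos T hT hcov
  obtain ⟨cm, hcm⟩ : ∃ cm, cm ∈ S := by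
    cases S with
    | nil => simp at hpos
    | cons a l => exact ⟨a, List.mem_cons_self⟩
  have hhub : (hub4, 24) ∈ T :=
    hcov _ hubE_mem_G ⟨cm, hcm, weakLive_of_weakLiveB ((allB_iff _ _).1 hub_above_GP cm (hS.subset hcm))⟩
  have h24 : 24 ≤ (T.map Prod.snd).sum :=
    List.single_le_sum (fun a _ => Nat.zero_le a) 24 (List.mem_map.2 ⟨(hub4, 24), hhub, rfl⟩)
  have hle : (S.map Prod.snd).sum ≤ (Ddiag.P.map Prod.snd).sum := (hS.map Prod.snd).sum_le_sum (fun a _ => Nat.zero_le a)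
  rw [massP_G] at hle
  omega

theorem hallUp_G : HallUp Ddiag := hallUp_of_hallPlusUp Ddiag 8 hallPlusUp8_G

theorem TG_sublist : TG.Sublist Ddiag.N := List.filter_sublist

theorem TG_covers : ∀ cn ∈ Ddiag.N, (∃ cm ∈ Ddiag.P, WeakLive cm.1 cn.1) → cn ∈ TG := by
  intro cn hcn hex
  obtain ⟨cm, hcm, hw⟩ := hex
  unfold TG
  exact List.mem_filter.2 ⟨hcn, (anyB_iff _ _).2 ⟨cm, hcm, weakLiveB_of hw⟩⟩

/-- and the surplus is TIGHT: `¬ HallPlusUp D◇ 9`. -/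
theorem not_hallPlusUp9_G : ¬ HallPlusUp Ddiag 9 := by
  intro h
  have h1 := h Ddiag.P (List.Sublist.refl _) (by rw [massP_G]; decide) TG TG_sublist TG_covers
  rw [massP_G, TG_capacity] at h1
  omega

theorem sigmaH_G : sigmaH Ddiag = 1568 := by
  unfold sigmaH
  rw [copies_G, extPN_G_one, extNP_G_three, extNN_G_two, extPP_G_two]
  norm_num

theorem budget_G : BudgetClause sigmaH 0 Ddiag := by
  unfold BudgetClause
  rw [sigmaH_G, rank_G]
  norm_num

theorem yd_detects : Detects yd (0 : Fin 4) (1 : Fin 4) := by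
  unfold Detects yd
  decide

/-- **`D◇` violates RULE D** (N-side) at `yd`, block `(0,1)`: two diagonal letters can only be supplied through level 11. -/
theorem not_ruleD_G : ¬ RuleD Ddiag := by
  intro h
  obtain ⟨x, hx, hs⟩ := h.1 yd yd_suppN (0 : Fin 4) (1 : Fin 4) (by decide) yd_detects
  obtain ⟨m, hm⟩ := exists_of_mem_suppP hx
  have hb := (allB_iff _ _).1 yd_noSupplier (x, m) hm
  rw [suppliesB_of hs] at hb
  exact Bool.noConfusion hb

/-- THE CERTIFICATE for `D◇` (height 14): every binder of `SPlus 14 sigmaH 0` except `RuleD`, off the axis room, all charged cells fully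
off-axis, N-mass 40, `μ = −128`. -/
theorem cert_G : Ddiag.OnAlphabet 14 ∧ ¬ AxisRoom Ddiag ∧ Disj Ddiag ∧ Ddiag.A1 ∧ HallUp Ddiag ∧ HallPlusUp Ddiag 8 ∧ Ddiag.mu = ⟨-128, 0⟩ ∧
    Ddiag.rank = 24 ∧ Ddiag.copies = 56 ∧ (Ddiag.N.map Prod.snd).sum = 40 ∧ sigmaH Ddiag = 1568 ∧ BudgetClause sigmaH 0 Ddiag ∧
    (∀ w : Word, w.efree → Ddiag.T w = ⟨24 * 14 ^ w.deg, 0⟩) ∧ ¬ HallPlusUp Ddiag 9 ∧ ¬ RuleD Ddiag :=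
  ⟨onAlphabet_G, not_axisRoom_G, disj_G, a1_G, hallUp_G, hallPlusUp8_G, mu_G, rank_G, copies_G, massN_G, sigmaH_G, budget_G, efree_rows_G,
    not_hallPlusUp9_G, not_ruleD_G⟩

/-- the two off-axis RULE-D-free inhabitants side by side: N-mass `41` (twin `D°`, same tensor as `D⋆`) and `40` (diagonal twin `D◇`). -/
theorem offAxis_ruleDfree_inhabitants :
    (¬ AxisRoom Dring ∧ Dring.A1 ∧ Dring.mu ≠ 0 ∧ Disj Dring ∧ HallPlusUp Dring 8 ∧ BudgetClause sigmaH 0 Dring ∧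
      (Dring.N.map Prod.snd).sum = 41 ∧ ¬ RuleD Dring) ∧
    (¬ AxisRoom Ddiag ∧ Ddiag.A1 ∧ Ddiag.mu ≠ 0 ∧ Disj Ddiag ∧ HallPlusUp Ddiag 8 ∧ BudgetClause sigmaH 0 Ddiag ∧
      (Ddiag.N.map Prod.snd).sum = 40 ∧ ¬ RuleD Ddiag) :=
  ⟨⟨not_axisRoom_T, a1_T, mu_ne_T, disj_T, hallPlusUp8_T, budget_T, massN_T, not_ruleD_T⟩,
   ⟨not_axisRoom_G, a1_G, mu_ne_G, disj_G, hallPlusUp8_G, budget_G, massN_G, not_ruleD_G⟩⟩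

end Summit.HodgeConjecture.HodgeConjecture.Cruxes.BlochSeedDiscOne.OffAxisTwin
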